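import Summits.ValiantsHypothesis.ValiantsHypothesis.Theorems.NewtonFramesTwoProductsFrameRungTwoShallowNeighbourCore

/-!
# Crux `TwoProducts` (stmt-5906), line `FrameRungTwo`: the OUT kernel of (IX) follows from its ONE-DIMENSIONAL form (real letters)

`…ShallowNeighbourCore.lean` (p636720/p637974) reduced `hIX` of p603280 to the OUT kernel `hOut` (letter sets in ℕ², a real functional
`lc`, the `lexKey` tie-break) and the cancellation kernel `hCancel`.  All numerics of the 5906 seats (memo-IX-blocks, -windows, -robust,
-g4) run in the 1-D model "letters = numbers, window = an initial segment".  This file proves the 1-D model FAITHFUL for the OUT kernel: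
`outKernel_of_oneD : hOut1D → hOut`, `hOut1D` being `hOut` with `Finset ℝ` letters, `≤` for the key order and `e + T' p = Σ w + y` as the
certificate (g3's remark 0′ made formal).  Mechanism (`exists_keyMonotone`): on a finite `F ⊆ ℕ²` the key order of `lc` is realised by the
ADDITIVE functional `q ↦ N·lc q + N′·q₀ + q₁` for explicit `N, N′`; the rest is transport (`outKernel_of_oneD`).  Consequences:
`shallowNeighbour_of_oneD_of_cancel` (`hOut1D ∧ hCancel ⇒ hIX` verbatim), `crossCancel_of_oneD_of_cancel` (the `k = 2` count).
Honest scope: a REDUCTION for ONE stub of a rung strictly below the crux `TwoProducts`; `hOut1D`, `hCancel` are NOT proved here; nothing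
here bears on `VP ≠ VNP`.  [ours; setting KPTT arXiv:1308.2286 §2, §5]
-/

set_option linter.dupNamespace false

namespace Summit.ValiantsHypothesis.ValiantsHypothesis.Theorems.NewtonFramesTwoProducts.FrameRungTwoTrinomial

open MvPolynomial
open scoped BigOperators Classical
open Summit.ValiantsHypothesis.Theorems.DissociatedFixedK (lexKey lexKey_injective)
open Summit.ValiantsHypothesis.ValiantsHypothesis.Theorems.DissociatedFixedK.Negative (emb emb_injective)
open Summit.ValiantsHypothesis.ValiantsHypothesis.Theorems.NewtonFramesTwoProducts.FrameRungTwoBinomial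
  (emb_add emb_sum apply_le_of_lexKey_le)

noncomputable section

section OneD

variable {m : ℕ}

/-- **Key order = an additive real functional, on any finite set.**  For a finite `F ⊆ ℕ²` and any functional `l` there are reals
`N, N'` such that `q ↦ N·l(q) + N'·q₀ + q₁` is strictly increasing for the `lexKey l` order on `F`.  (`N' = 1 + Σ_F q₁` beats every
second coordinate, `N = 1 + Σ_{pairs} (C+1)/(l q' − l q)` beats the tie-break part `C = Σ_F (N' q₀ + q₁)`.) [folklore] -/
theorem exists_keyMonotone (l : (Fin 2 → ℝ) →L[ℝ] ℝ) (F : Finset (Fin 2 →₀ ℕ)) :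
    ∃ N N' : ℝ, ∀ q ∈ F, ∀ q' ∈ F, lexKey l q < lexKey l q' →
      N * l (emb q) + N' * ((q 0 : ℕ) : ℝ) + ((q 1 : ℕ) : ℝ) <
        N * l (emb q') + N' * ((q' 0 : ℕ) : ℝ) + ((q' 1 : ℕ) : ℝ) := by
  set N' : ℝ := 1 + ∑ r ∈ F, ((r 1 : ℕ) : ℝ) with hN'
  set C : ℝ := ∑ r ∈ F, (N' * ((r 0 : ℕ) : ℝ) + ((r 1 : ℕ) : ℝ)) with hC
  set P : Finset ((Fin 2 →₀ ℕ) × (Fin 2 →₀ ℕ)) := (F ×ˢ F).filter fun pq => l (emb pq.1) < l (emb pq.2) with hP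
  set N : ℝ := 1 + ∑ pq ∈ P, (C + 1) / (l (emb pq.2) - l (emb pq.1)) with hN
  have hN'pos : 0 < N' := by
    rw [hN']; exact add_pos_of_pos_of_nonneg one_pos (Finset.sum_nonneg fun r _ => Nat.cast_nonneg _)
  have hN'1 : 1 ≤ N' := by
    rw [hN']; exact le_add_of_nonneg_right (Finset.sum_nonneg fun r _ => Nat.cast_nonneg _)
  have hq1 : ∀ q ∈ F, ((q 1 : ℕ) : ℝ) < N' := by
    intro q hq
    rw [hN']
    have h := Finset.single_le_sum (f := fun r : Fin 2 →₀ ℕ => ((r 1 : ℕ) : ℝ)) (fun r _ => Nat.cast_nonneg _) hq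
    linarith
  have hCq : ∀ q ∈ F, N' * ((q 0 : ℕ) : ℝ) + ((q 1 : ℕ) : ℝ) ≤ C := by
    intro q hq
    rw [hC]
    exact Finset.single_le_sum (f := fun r : Fin 2 →₀ ℕ => N' * ((r 0 : ℕ) : ℝ) + ((r 1 : ℕ) : ℝ))
      (fun r _ => add_nonneg (mul_nonneg hN'pos.le (Nat.cast_nonneg _)) (Nat.cast_nonneg _)) hq
  have hCnonneg : ∀ q : Fin 2 →₀ ℕ, 0 ≤ N' * ((q 0 : ℕ) : ℝ) + ((q 1 : ℕ) : ℝ) := fun q =>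
    add_nonneg (mul_nonneg hN'pos.le (Nat.cast_nonneg _)) (Nat.cast_nonneg _)
  have hC0 : 0 ≤ C := by rw [hC]; exact Finset.sum_nonneg fun r _ => hCnonneg r
  have hNpair : ∀ q ∈ F, ∀ q' ∈ F, l (emb q) < l (emb q') → C + 1 ≤ N * (l (emb q') - l (emb q)) := by
    intro q hq q' hq' hlt
    have hmem : (q, q') ∈ P := by
      rw [hP, Finset.mem_filter]; exact ⟨Finset.mk_mem_product hq hq', hlt⟩
    have hd : 0 < l (emb q') - l (emb q) := sub_pos.2 hlt
    have hterm : (C + 1) / (l (emb q') - l (emb q)) ≤ ∑ pq ∈ P, (C + 1) / (l (emb pq.2) - l (emb pq.1)) := by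
      apply Finset.single_le_sum (f := fun pq : (Fin 2 →₀ ℕ) × (Fin 2 →₀ ℕ) => (C + 1) / (l (emb pq.2) - l (emb pq.1))) _ hmem
      intro pq hpq
      rw [hP, Finset.mem_filter] at hpq
      exact div_nonneg (by linarith) (sub_pos.2 hpq.2).le
    have hNge : (C + 1) / (l (emb q') - l (emb q)) ≤ N := by rw [hN]; linarith
    calc C + 1 = (C + 1) / (l (emb q') - l (emb q)) * (l (emb q') - l (emb q)) := by
            rw [div_mul_cancel₀ _ hd.ne']
      _ ≤ N * (l (emb q') - l (emb q)) := mul_le_mul_of_nonneg_right hNge hd.le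
  refine ⟨N, N', fun q hq q' hq' hlt => ?_⟩
  simp only [lexKey, Prod.Lex.lt_iff] at hlt
  rcases hlt with hl | ⟨hl, h0 | ⟨h0, h1⟩⟩
  · -- strict `l`-inequality: N (l q' − l q) ≥ C + 1 > |tie-break difference|
    have h := hNpair q hq q' hq' hl
    have hb := hCq q hq
    have hb' := hCnonneg q'
    nlinarith [hb, hb', h]
  · -- equal `l`, first coordinate decides
    have hl' : l (emb q) = l (emb q') := hl
    have h0n : q 0 < q' 0 := h0
    have h0' : ((q 0 : ℕ) : ℝ) + 1 ≤ ((q' 0 : ℕ) : ℝ) := by exact_mod_cast h0n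
    have h1b := hq1 q hq
    have h1n : (0 : ℝ) ≤ ((q' 1 : ℕ) : ℝ) := Nat.cast_nonneg _
    rw [hl']
    nlinarith [mul_le_mul_of_nonneg_left h0' hN'pos.le, h1b, h1n, hN'1]
  · -- equal `l` and first coordinate, second coordinate decides
    have hl' : l (emb q) = l (emb q') := hl
    have h0n : q 0 = q' 0 := h0
    have h1n : q 1 < q' 1 := h1
    have h1' : ((q 1 : ℕ) : ℝ) < ((q' 1 : ℕ) : ℝ) := by exact_mod_cast h1n
    rw [hl', h0n]
    linarith

/-- Lifting a word of the image family to a word of the original family. [folklore] -/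
theorem lift_word {α β : Type*} (S : Fin m → Finset α) (φ : α → β) (b1 : Fin m → β)
    (h : ∀ j, b1 j ∈ (S j).image φ) : ∃ b : Fin m → α, (∀ j, b j ∈ S j) ∧ ∀ j, φ (b j) = b1 j := by
  have hc : ∀ j, ∃ x, x ∈ S j ∧ φ x = b1 j := fun j => by
    obtain ⟨x, hx, hxe⟩ := Finset.mem_image.1 (h j); exact ⟨x, hx, hxe⟩
  choose b hb hbe using hc
  exact ⟨b, hb, hbe⟩

/-- **The OUT kernel from its one-dimensional form.**  `h1D` is `hOut` of `shallowNeighbour_of_cores` with real letters, the usual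
order and the certificate `e + T' p = Σ w + y`; the conclusion is `hOut` verbatim.  Proof: embed the finite set of relevant lattice
points (letters, word sums, `e`, `Σ w + y`, `e + y`) into ℝ by the key-monotone additive functional of `exists_keyMonotone` and
transport every hypothesis and the certificate. [ours] -/
theorem outKernel_of_oneD
    (h1D : ∀ (S S' : Fin m → Finset ℝ) (e : ℝ) (T T' a : Fin m → ℝ),
      (∀ b c : Fin m → ℝ, (∀ j, b j ∈ S j) → (∀ j, c j ∈ S j) → ∑ j, b j = ∑ j, c j → b = c) →
      (∀ b c : Fin m → ℝ, (∀ j, b j ∈ S' j) → (∀ j, c j ∈ S' j) → ∑ j, b j = ∑ j, c j → b = c) →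
      (∀ j, T j ∈ S j) → (∀ j, ∀ x ∈ S j, x ≤ T j) → (∀ j, T' j ∈ S' j) → (∀ j, ∀ x ∈ S' j, x ≤ T' j) →
      (∀ j, a j ∈ S j) → ∑ j, a j = e → ∑ j, T j = ∑ j, T' j → e < ∑ j, T j →
      (∀ b : Fin m → ℝ, (∀ j, b j ∈ S j) → ∑ j, b j ≠ e → e ≤ ∑ j, b j →
        ∃ c : Fin m → ℝ, (∀ j, c j ∈ S' j) ∧ ∑ j, c j = ∑ j, b j) →
      (∀ c : Fin m → ℝ, (∀ j, c j ∈ S' j) → ∑ j, c j ≠ e → e ≤ ∑ j, c j →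
        ∃ b : Fin m → ℝ, (∀ j, b j ∈ S j) ∧ ∑ j, b j = ∑ j, c j) →
      (∀ c : Fin m → ℝ, (∀ j, c j ∈ S' j) → ∑ j, c j ≠ e) →
      4 ≤ (Finset.univ.filter fun i => a i ≠ T i).card →
      ∃ (w : Fin m → ℝ) (p : Fin m) (y : ℝ), (∀ i, w i ∈ S' i) ∧
        (Finset.univ.filter fun i => w i ≠ T' i).card ≤ 2 ∧ y ∈ S' p ∧ e + T' p = ∑ i, w i + y) :
    ∀ (S S' : Fin m → Finset (Fin 2 →₀ ℕ)) (lc : (Fin 2 → ℝ) →L[ℝ] ℝ) (e : Fin 2 →₀ ℕ)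
        (T T' a : Fin m → (Fin 2 →₀ ℕ)),
      (∀ b c : Fin m → (Fin 2 →₀ ℕ), (∀ j, b j ∈ S j) → (∀ j, c j ∈ S j) → ∑ j, b j = ∑ j, c j → b = c) →
      (∀ b c : Fin m → (Fin 2 →₀ ℕ), (∀ j, b j ∈ S' j) → (∀ j, c j ∈ S' j) → ∑ j, b j = ∑ j, c j → b = c) →
      (∀ j, T j ∈ S j) → (∀ j, ∀ x ∈ S j, lexKey lc x ≤ lexKey lc (T j)) →
      (∀ j, T' j ∈ S' j) → (∀ j, ∀ x ∈ S' j, lexKey lc x ≤ lexKey lc (T' j)) →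
      (∀ j, a j ∈ S j) → ∑ j, a j = e → ∑ j, T j = ∑ j, T' j → lexKey lc e < lexKey lc (∑ j, T j) →
      (∀ b : Fin m → (Fin 2 →₀ ℕ), (∀ j, b j ∈ S j) → ∑ j, b j ≠ e → lc (emb e) ≤ lc (emb (∑ j, b j)) →
        ∃ c : Fin m → (Fin 2 →₀ ℕ), (∀ j, c j ∈ S' j) ∧ ∑ j, c j = ∑ j, b j) →
      (∀ c : Fin m → (Fin 2 →₀ ℕ), (∀ j, c j ∈ S' j) → ∑ j, c j ≠ e → lc (emb e) ≤ lc (emb (∑ j, c j)) →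
        ∃ b : Fin m → (Fin 2 →₀ ℕ), (∀ j, b j ∈ S j) ∧ ∑ j, b j = ∑ j, c j) →
      (∀ c : Fin m → (Fin 2 →₀ ℕ), (∀ j, c j ∈ S' j) → ∑ j, c j ≠ e) →
      4 ≤ (Finset.univ.filter fun i => a i ≠ T i).card →
      ∃ (w : Fin m → (Fin 2 →₀ ℕ)) (p : Fin m) (y : Fin 2 →₀ ℕ), (∀ i, w i ∈ S' i) ∧
        (Finset.univ.filter fun i => w i ≠ T' i).card ≤ 2 ∧ y ∈ S' p ∧
        emb e = emb (∑ i, w i) - (emb (T' p) - emb y) := by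
  intro S S' lc e T T' a hS hS' hT hTmax hT' hTmax' ha hae htop hTe hwin hwin' hout h4
  set L : Finset (Fin 2 →₀ ℕ) := Finset.univ.biUnion S with hL
  set L' : Finset (Fin 2 →₀ ℕ) := Finset.univ.biUnion S' with hL'
  set W : Finset (Fin 2 →₀ ℕ) := (Fintype.piFinset S).image fun b => ∑ j, b j with hW
  set W' : Finset (Fin 2 →₀ ℕ) := (Fintype.piFinset S').image fun c => ∑ j, c j with hW'
  set V : Finset (Fin 2 →₀ ℕ) := ((Fintype.piFinset S') ×ˢ L').image fun q => ∑ j, q.1 j + q.2 with hV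
  set E : Finset (Fin 2 →₀ ℕ) := L'.image fun y => e + y with hE
  set F : Finset (Fin 2 →₀ ℕ) := L ∪ L' ∪ W ∪ W' ∪ {e} ∪ V ∪ E with hF
  have hLmem : ∀ j, ∀ x ∈ S j, x ∈ F := fun j x hx => by
    rw [hF]; simp only [Finset.mem_union]
    exact Or.inl (Or.inl (Or.inl (Or.inl (Or.inl (Or.inl (by rw [hL, Finset.mem_biUnion]; exact ⟨j, Finset.mem_univ _, hx⟩))))))
  have hL'mem : ∀ j, ∀ x ∈ S' j, x ∈ F := fun j x hx => by
    rw [hF]; simp only [Finset.mem_union]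
    exact Or.inl (Or.inl (Or.inl (Or.inl (Or.inl (Or.inr (by rw [hL', Finset.mem_biUnion]; exact ⟨j, Finset.mem_univ _, hx⟩))))))
  have hWmem : ∀ b : Fin m → (Fin 2 →₀ ℕ), (∀ j, b j ∈ S j) → ∑ j, b j ∈ F := fun b hb => by
    rw [hF]; simp only [Finset.mem_union]
    refine Or.inl (Or.inl (Or.inl (Or.inl (Or.inr ?_))))
    rw [hW, Finset.mem_image]; exact ⟨b, Fintype.mem_piFinset.2 hb, rfl⟩
  have hW'mem : ∀ c : Fin m → (Fin 2 →₀ ℕ), (∀ j, c j ∈ S' j) → ∑ j, c j ∈ F := fun c hc => by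
    rw [hF]; simp only [Finset.mem_union]
    refine Or.inl (Or.inl (Or.inl (Or.inr ?_)))
    rw [hW', Finset.mem_image]; exact ⟨c, Fintype.mem_piFinset.2 hc, rfl⟩
  have hemem : e ∈ F := by
    rw [hF]; simp
  have hVmem : ∀ (c : Fin m → (Fin 2 →₀ ℕ)) (p : Fin m) (y : Fin 2 →₀ ℕ), (∀ j, c j ∈ S' j) → y ∈ S' p →
      ∑ j, c j + y ∈ F := fun c p y hc hy => by
    rw [hF]; simp only [Finset.mem_union]
    refine Or.inl (Or.inr ?_)
    rw [hV, Finset.mem_image]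
    refine ⟨(c, y), Finset.mk_mem_product (Fintype.mem_piFinset.2 hc) ?_, rfl⟩
    rw [hL', Finset.mem_biUnion]; exact ⟨p, Finset.mem_univ _, hy⟩
  have hEmem : ∀ (p : Fin m) (y : Fin 2 →₀ ℕ), y ∈ S' p → e + y ∈ F := fun p y hy => by
    rw [hF]; simp only [Finset.mem_union]
    refine Or.inr ?_
    rw [hE, Finset.mem_image]
    exact ⟨y, by rw [hL', Finset.mem_biUnion]; exact ⟨p, Finset.mem_univ _, hy⟩, rfl⟩
  obtain ⟨N, N', hmono⟩ := exists_keyMonotone lc F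
  let φ : (Fin 2 →₀ ℕ) →+ ℝ :=
    { toFun := fun q => N * lc (emb q) + N' * ((q 0 : ℕ) : ℝ) + ((q 1 : ℕ) : ℝ)
      map_zero' := by
        have h0 : emb 0 = 0 := by funext i; simp [emb]
        simp [h0]
      map_add' := fun x y => by
        simp only [emb_add, map_add, Finsupp.add_apply, Nat.cast_add]; ring }
  have hφ : ∀ q, φ q = N * lc (emb q) + N' * ((q 0 : ℕ) : ℝ) + ((q 1 : ℕ) : ℝ) := fun q => rfl
  have hlt : ∀ q ∈ F, ∀ q' ∈ F, lexKey lc q < lexKey lc q' → φ q < φ q' := fun q hq q' hq' h => by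
    rw [hφ, hφ]; exact hmono q hq q' hq' h
  have hinj : ∀ q ∈ F, ∀ q' ∈ F, φ q = φ q' → q = q' := by
    intro q hq q' hq' h
    rcases lt_trichotomy (lexKey lc q) (lexKey lc q') with hlt' | heq | hgt
    · exact absurd h (hlt q hq q' hq' hlt').ne
    · exact lexKey_injective lc heq
    · exact absurd h.symm (hlt q' hq' q hq hgt).ne
  have hle : ∀ q ∈ F, ∀ q' ∈ F, lexKey lc q ≤ lexKey lc q' → φ q ≤ φ q' := by
    intro q hq q' hq' h
    rcases h.lt_or_eq with h | h
    · exact (hlt q hq q' hq' h).le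
    · rw [lexKey_injective lc h]
  have hkey_of_le : ∀ q ∈ F, ∀ q' ∈ F, φ q ≤ φ q' → lexKey lc q ≤ lexKey lc q' := by
    intro q hq q' hq' h
    by_contra hc
    exact absurd h (not_le.2 (hlt q' hq' q hq (not_le.1 hc)))
  have hφsum : ∀ b : Fin m → (Fin 2 →₀ ℕ), φ (∑ j, b j) = ∑ j, φ (b j) := fun b => map_sum φ b Finset.univ
  set S1 : Fin m → Finset ℝ := fun j => (S j).image φ with hS1
  set S1' : Fin m → Finset ℝ := fun j => (S' j).image φ with hS1'
  have hS1d : ∀ b c : Fin m → ℝ, (∀ j, b j ∈ S1 j) → (∀ j, c j ∈ S1 j) → ∑ j, b j = ∑ j, c j → b = c := by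
    intro b1 c1 hb1 hc1 hsum
    obtain ⟨b, hb, hbe⟩ := lift_word S φ b1 hb1
    obtain ⟨c, hc, hce⟩ := lift_word S φ c1 hc1
    have h1 : φ (∑ j, b j) = φ (∑ j, c j) := by
      rw [hφsum, hφsum]
      calc ∑ j, φ (b j) = ∑ j, b1 j := Finset.sum_congr rfl fun j _ => hbe j
        _ = ∑ j, c1 j := hsum
        _ = ∑ j, φ (c j) := Finset.sum_congr rfl fun j _ => (hce j).symm
    have h2 : b = c := hS b c hb hc (hinj _ (hWmem b hb) _ (hWmem c hc) h1)
    funext j; rw [← hbe j, ← hce j, h2]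
  have hS1'd : ∀ b c : Fin m → ℝ, (∀ j, b j ∈ S1' j) → (∀ j, c j ∈ S1' j) → ∑ j, b j = ∑ j, c j → b = c := by
    intro b1 c1 hb1 hc1 hsum
    obtain ⟨b, hb, hbe⟩ := lift_word S' φ b1 hb1
    obtain ⟨c, hc, hce⟩ := lift_word S' φ c1 hc1
    have h1 : φ (∑ j, b j) = φ (∑ j, c j) := by
      rw [hφsum, hφsum]
      calc ∑ j, φ (b j) = ∑ j, b1 j := Finset.sum_congr rfl fun j _ => hbe j
        _ = ∑ j, c1 j := hsum
        _ = ∑ j, φ (c j) := Finset.sum_congr rfl fun j _ => (hce j).symm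
    have h2 : b = c := hS' b c hb hc (hinj _ (hW'mem b hb) _ (hW'mem c hc) h1)
    funext j; rw [← hbe j, ← hce j, h2]
  have hT1 : ∀ j, φ (T j) ∈ S1 j := fun j => Finset.mem_image_of_mem _ (hT j)
  have hT1max : ∀ j, ∀ x ∈ S1 j, x ≤ φ (T j) := by
    intro j x1 hx1
    obtain ⟨x, hx, rfl⟩ := Finset.mem_image.1 hx1
    exact hle x (hLmem j x hx) (T j) (hLmem j _ (hT j)) (hTmax j x hx)
  have hT1' : ∀ j, φ (T' j) ∈ S1' j := fun j => Finset.mem_image_of_mem _ (hT' j)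
  have hT1max' : ∀ j, ∀ x ∈ S1' j, x ≤ φ (T' j) := by
    intro j x1 hx1
    obtain ⟨x, hx, rfl⟩ := Finset.mem_image.1 hx1
    exact hle x (hL'mem j x hx) (T' j) (hL'mem j _ (hT' j)) (hTmax' j x hx)
  have ha1 : ∀ j, φ (a j) ∈ S1 j := fun j => Finset.mem_image_of_mem _ (ha j)
  have hae1 : ∑ j, φ (a j) = φ e := by rw [← hφsum, hae]
  have htop1 : ∑ j, φ (T j) = ∑ j, φ (T' j) := by rw [← hφsum, ← hφsum, htop]
  have hTe1 : φ e < ∑ j, φ (T j) := by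
    rw [← hφsum]; exact hlt e hemem _ (hWmem T hT) hTe
  have hwin1 : ∀ b : Fin m → ℝ, (∀ j, b j ∈ S1 j) → ∑ j, b j ≠ φ e → φ e ≤ ∑ j, b j →
      ∃ c : Fin m → ℝ, (∀ j, c j ∈ S1' j) ∧ ∑ j, c j = ∑ j, b j := by
    intro b1 hb1 hne hge
    obtain ⟨b, hb, hbe⟩ := lift_word S φ b1 hb1
    have hsum : ∑ j, b1 j = φ (∑ j, b j) := by
      rw [hφsum]; exact Finset.sum_congr rfl fun j _ => (hbe j).symm
    rw [hsum] at hne hge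
    have hne' : ∑ j, b j ≠ e := fun h => hne (by rw [h])
    have hkey := hkey_of_le e hemem _ (hWmem b hb) hge
    obtain ⟨c, hc, hcs⟩ := hwin b hb hne' (apply_le_of_lexKey_le lc hkey)
    refine ⟨fun j => φ (c j), fun j => Finset.mem_image_of_mem _ (hc j), ?_⟩
    rw [hsum, ← hφsum, hcs]
  have hwin1' : ∀ c : Fin m → ℝ, (∀ j, c j ∈ S1' j) → ∑ j, c j ≠ φ e → φ e ≤ ∑ j, c j →
      ∃ b : Fin m → ℝ, (∀ j, b j ∈ S1 j) ∧ ∑ j, b j = ∑ j, c j := by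
    intro c1 hc1 hne hge
    obtain ⟨c, hc, hce⟩ := lift_word S' φ c1 hc1
    have hsum : ∑ j, c1 j = φ (∑ j, c j) := by
      rw [hφsum]; exact Finset.sum_congr rfl fun j _ => (hce j).symm
    rw [hsum] at hne hge
    have hne' : ∑ j, c j ≠ e := fun h => hne (by rw [h])
    have hkey := hkey_of_le e hemem _ (hW'mem c hc) hge
    obtain ⟨b, hb, hbs⟩ := hwin' c hc hne' (apply_le_of_lexKey_le lc hkey)
    refine ⟨fun j => φ (b j), fun j => Finset.mem_image_of_mem _ (hb j), ?_⟩
    rw [hsum, ← hφsum, hbs]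
  have hout1 : ∀ c : Fin m → ℝ, (∀ j, c j ∈ S1' j) → ∑ j, c j ≠ φ e := by
    intro c1 hc1 h
    obtain ⟨c, hc, hce⟩ := lift_word S' φ c1 hc1
    have hsum : φ (∑ j, c j) = φ e := by
      rw [hφsum, ← h]; exact Finset.sum_congr rfl fun j _ => hce j
    exact hout c hc (hinj _ (hW'mem c hc) e hemem hsum)
  have hfilt : (Finset.univ.filter fun i => φ (a i) ≠ φ (T i)) = (Finset.univ.filter fun i => a i ≠ T i) := by
    ext i
    simp only [Finset.mem_filter, Finset.mem_univ, true_and]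
    exact ⟨fun h hc => h (by rw [hc]), fun h hc => h (hinj _ (hLmem i _ (ha i)) _ (hLmem i _ (hT i)) hc)⟩
  have h41 : 4 ≤ (Finset.univ.filter fun i => φ (a i) ≠ φ (T i)).card := by rw [hfilt]; exact h4
  obtain ⟨w1, p, y1, hw1, hw1c, hy1, hEq⟩ := h1D S1 S1' (φ e) (fun j => φ (T j)) (fun j => φ (T' j))
    (fun j => φ (a j)) hS1d hS1'd hT1 hT1max hT1' hT1max' ha1 hae1 htop1 hTe1 hwin1 hwin1' hout1 h41
  obtain ⟨w, hw, hwe⟩ := lift_word S' φ w1 hw1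
  obtain ⟨y, hy, hye⟩ := Finset.mem_image.1 hy1
  refine ⟨w, p, y, hw, ?_, hy, ?_⟩
  · have hfw : (Finset.univ.filter fun i => w i ≠ T' i) = (Finset.univ.filter fun i => w1 i ≠ φ (T' i)) := by
      ext i
      simp only [Finset.mem_filter, Finset.mem_univ, true_and]
      rw [← hwe i]
      exact ⟨fun h hc => h (hinj _ (hL'mem i _ (hw i)) _ (hL'mem i _ (hT' i)) hc), fun h hc => h (by rw [hc])⟩
    rw [hfw]; exact hw1c
  · have h1 : φ (e + T' p) = φ (∑ i, w i + y) := by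
      rw [map_add, map_add, hEq, hφsum, hye]
      congr 1
      exact Finset.sum_congr rfl fun j _ => (hwe j).symm
    have h2 : e + T' p = ∑ i, w i + y := hinj _ (hEmem p _ (hT' p)) _ (hVmem w p y hw hy) h1
    have h3 : emb e + emb (T' p) = emb (∑ i, w i) + emb y := by rw [← emb_add, ← emb_add, h2]
    have h4 : emb e = emb (∑ i, w i) + emb y - emb (T' p) := by rw [← h3]; abel
    rw [h4]; abel

/-- **(IX) from the 1-D kernel and deep–deep cancellation.**  `hIX` of `crossCancel_of_shallowNeighbour` (p603280) VERBATIM, for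
dissociated `f`, `g`, from `h1D` (the OUT kernel with real letters) and `hCancel` (Q4′ in weight form), via `outKernel_of_oneD`,
`bothKernel_of_cancel` and `shallowNeighbour_of_cores`. [ours] -/
theorem shallowNeighbour_of_oneD_of_cancel (f g : Fin m → MvPolynomial (Fin 2) ℂ)
    (hinjf : ∀ a b : Fin m → (Fin 2 →₀ ℕ), (∀ j, a j ∈ (f j).support) → (∀ j, b j ∈ (f j).support) →
      ∑ j, a j = ∑ j, b j → a = b)
    (hinjg : ∀ a b : Fin m → (Fin 2 →₀ ℕ), (∀ j, a j ∈ (g j).support) → (∀ j, b j ∈ (g j).support) →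
      ∑ j, a j = ∑ j, b j → a = b)
    (h1D : ∀ (S S' : Fin m → Finset ℝ) (e : ℝ) (T T' a : Fin m → ℝ),
      (∀ b c : Fin m → ℝ, (∀ j, b j ∈ S j) → (∀ j, c j ∈ S j) → ∑ j, b j = ∑ j, c j → b = c) →
      (∀ b c : Fin m → ℝ, (∀ j, b j ∈ S' j) → (∀ j, c j ∈ S' j) → ∑ j, b j = ∑ j, c j → b = c) →
      (∀ j, T j ∈ S j) → (∀ j, ∀ x ∈ S j, x ≤ T j) → (∀ j, T' j ∈ S' j) → (∀ j, ∀ x ∈ S' j, x ≤ T' j) →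
      (∀ j, a j ∈ S j) → ∑ j, a j = e → ∑ j, T j = ∑ j, T' j → e < ∑ j, T j →
      (∀ b : Fin m → ℝ, (∀ j, b j ∈ S j) → ∑ j, b j ≠ e → e ≤ ∑ j, b j →
        ∃ c : Fin m → ℝ, (∀ j, c j ∈ S' j) ∧ ∑ j, c j = ∑ j, b j) →
      (∀ c : Fin m → ℝ, (∀ j, c j ∈ S' j) → ∑ j, c j ≠ e → e ≤ ∑ j, c j →
        ∃ b : Fin m → ℝ, (∀ j, b j ∈ S j) ∧ ∑ j, b j = ∑ j, c j) →
      (∀ c : Fin m → ℝ, (∀ j, c j ∈ S' j) → ∑ j, c j ≠ e) →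
      4 ≤ (Finset.univ.filter fun i => a i ≠ T i).card →
      ∃ (w : Fin m → ℝ) (p : Fin m) (y : ℝ), (∀ i, w i ∈ S' i) ∧
        (Finset.univ.filter fun i => w i ≠ T' i).card ≤ 2 ∧ y ∈ S' p ∧ e + T' p = ∑ i, w i + y)
    (hCancel : ∀ (S S' : Fin m → Finset (Fin 2 →₀ ℕ)) (lc : (Fin 2 → ℝ) →L[ℝ] ℝ) (e : Fin 2 →₀ ℕ)
        (T T' a u : Fin m → (Fin 2 →₀ ℕ)) (cf cg : Fin m → (Fin 2 →₀ ℕ) → ℂ),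
      (∀ b c : Fin m → (Fin 2 →₀ ℕ), (∀ j, b j ∈ S j) → (∀ j, c j ∈ S j) → ∑ j, b j = ∑ j, c j → b = c) →
      (∀ b c : Fin m → (Fin 2 →₀ ℕ), (∀ j, b j ∈ S' j) → (∀ j, c j ∈ S' j) → ∑ j, b j = ∑ j, c j → b = c) →
      (∀ j, T j ∈ S j) → (∀ j, ∀ x ∈ S j, lexKey lc x ≤ lexKey lc (T j)) →
      (∀ j, T' j ∈ S' j) → (∀ j, ∀ x ∈ S' j, lexKey lc x ≤ lexKey lc (T' j)) →
      (∀ j, a j ∈ S j) → ∑ j, a j = e → (∀ j, u j ∈ S' j) → ∑ j, u j = e →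
      ∑ j, T j = ∑ j, T' j → lexKey lc e < lexKey lc (∑ j, T j) →
      (∀ b : Fin m → (Fin 2 →₀ ℕ), (∀ j, b j ∈ S j) → ∑ j, b j ≠ e → lc (emb e) ≤ lc (emb (∑ j, b j)) →
        ∃ c : Fin m → (Fin 2 →₀ ℕ), (∀ j, c j ∈ S' j) ∧ ∑ j, c j = ∑ j, b j) →
      (∀ c : Fin m → (Fin 2 →₀ ℕ), (∀ j, c j ∈ S' j) → ∑ j, c j ≠ e → lc (emb e) ≤ lc (emb (∑ j, c j)) →
        ∃ b : Fin m → (Fin 2 →₀ ℕ), (∀ j, b j ∈ S j) ∧ ∑ j, b j = ∑ j, c j) →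
      4 ≤ (Finset.univ.filter fun i => a i ≠ T i).card → 4 ≤ (Finset.univ.filter fun i => u i ≠ T' i).card →
      (∀ j, ∀ x ∈ S j, cf j x ≠ 0) → (∀ j, ∀ x ∈ S' j, cg j x ≠ 0) →
      (∀ b c : Fin m → (Fin 2 →₀ ℕ), (∀ j, b j ∈ S j) → (∀ j, c j ∈ S' j) → ∑ j, b j = ∑ j, c j →
        ∑ j, b j ≠ e → lc (emb e) ≤ lc (emb (∑ j, b j)) → ∏ j, cf j (b j) + ∏ j, cg j (c j) = 0) →
      ∏ j, cf j (a j) + ∏ j, cg j (u j) = 0) :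
    ∀ (lc : (Fin 2 → ℝ) →L[ℝ] ℝ) (e : Fin 2 →₀ ℕ) (T T' a : Fin m → (Fin 2 →₀ ℕ)),
      (∀ j, T j ∈ (f j).support) → (∀ j, ∀ x ∈ (f j).support, lexKey lc x ≤ lexKey lc (T j)) →
      (∀ j, T' j ∈ (g j).support) → (∀ j, ∀ x ∈ (g j).support, lexKey lc x ≤ lexKey lc (T' j)) →
      (∀ j, a j ∈ (f j).support) → ∑ j, a j = e →
      (∀ x : Fin 2 →₀ ℕ, x ≠ e → lc (emb e) ≤ lc (emb x) → coeff x (∏ j, f j) + coeff x (∏ j, g j) = 0) →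
      coeff e (∏ j, f j) + coeff e (∏ j, g j) ≠ 0 → ∑ j, T j = ∑ j, T' j → lexKey lc e < lexKey lc (∑ j, T j) →
      (Finset.univ.filter fun i => a i ≠ T i).card ≤ 3 ∨
        ∃ (w : Fin m → (Fin 2 →₀ ℕ)) (p : Fin m) (y : Fin 2 →₀ ℕ), (∀ i, w i ∈ (g i).support) ∧
          (Finset.univ.filter fun i => w i ≠ T' i).card ≤ 2 ∧ y ∈ (g p).support ∧
          emb e = emb (∑ i, w i) - (emb (T' p) - emb y) :=
  shallowNeighbour_of_cores f g hinjf hinjg (outKernel_of_oneD h1D) (bothKernel_of_cancel hCancel)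

/-- **The `k = 2` cross-cancelling count from the 1-D kernel and deep–deep cancellation**: for every pair of dissociated frames
(any `t`, carries allowed) the cross-cancelling vertices of `Π f + Π g` number `≤ (m t + 2)^8`, given `h1D` and `hCancel`. [ours] -/
theorem crossCancel_of_oneD_of_cancel (m t : ℕ) (A B : Fin m → Finset (Fin 2 →₀ ℕ))
    (f g : Fin m → MvPolynomial (Fin 2) ℂ)
    (hA : ∀ j, (A j).card ≤ t) (hB : ∀ j, (B j).card ≤ t)
    (hf : ∀ j, (f j).support ⊆ A j) (hg : ∀ j, (g j).support ⊆ B j)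
    (hinjA : ∀ a b : Fin m → (Fin 2 →₀ ℕ), (∀ j, a j ∈ A j) → (∀ j, b j ∈ A j) → ∑ j, a j = ∑ j, b j → a = b)
    (hinjB : ∀ a b : Fin m → (Fin 2 →₀ ℕ), (∀ j, a j ∈ B j) → (∀ j, b j ∈ B j) → ∑ j, a j = ∑ j, b j → a = b)
    (h1D : ∀ (S S' : Fin m → Finset ℝ) (e : ℝ) (T T' a : Fin m → ℝ),
      (∀ b c : Fin m → ℝ, (∀ j, b j ∈ S j) → (∀ j, c j ∈ S j) → ∑ j, b j = ∑ j, c j → b = c) →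
      (∀ b c : Fin m → ℝ, (∀ j, b j ∈ S' j) → (∀ j, c j ∈ S' j) → ∑ j, b j = ∑ j, c j → b = c) →
      (∀ j, T j ∈ S j) → (∀ j, ∀ x ∈ S j, x ≤ T j) → (∀ j, T' j ∈ S' j) → (∀ j, ∀ x ∈ S' j, x ≤ T' j) →
      (∀ j, a j ∈ S j) → ∑ j, a j = e → ∑ j, T j = ∑ j, T' j → e < ∑ j, T j →
      (∀ b : Fin m → ℝ, (∀ j, b j ∈ S j) → ∑ j, b j ≠ e → e ≤ ∑ j, b j →
        ∃ c : Fin m → ℝ, (∀ j, c j ∈ S' j) ∧ ∑ j, c j = ∑ j, b j) →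
      (∀ c : Fin m → ℝ, (∀ j, c j ∈ S' j) → ∑ j, c j ≠ e → e ≤ ∑ j, c j →
        ∃ b : Fin m → ℝ, (∀ j, b j ∈ S j) ∧ ∑ j, b j = ∑ j, c j) →
      (∀ c : Fin m → ℝ, (∀ j, c j ∈ S' j) → ∑ j, c j ≠ e) →
      4 ≤ (Finset.univ.filter fun i => a i ≠ T i).card →
      ∃ (w : Fin m → ℝ) (p : Fin m) (y : ℝ), (∀ i, w i ∈ S' i) ∧
        (Finset.univ.filter fun i => w i ≠ T' i).card ≤ 2 ∧ y ∈ S' p ∧ e + T' p = ∑ i, w i + y)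
    (hCancel : ∀ (S S' : Fin m → Finset (Fin 2 →₀ ℕ)) (lc : (Fin 2 → ℝ) →L[ℝ] ℝ) (e : Fin 2 →₀ ℕ)
        (T T' a u : Fin m → (Fin 2 →₀ ℕ)) (cf cg : Fin m → (Fin 2 →₀ ℕ) → ℂ),
      (∀ b c : Fin m → (Fin 2 →₀ ℕ), (∀ j, b j ∈ S j) → (∀ j, c j ∈ S j) → ∑ j, b j = ∑ j, c j → b = c) →
      (∀ b c : Fin m → (Fin 2 →₀ ℕ), (∀ j, b j ∈ S' j) → (∀ j, c j ∈ S' j) → ∑ j, b j = ∑ j, c j → b = c) →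
      (∀ j, T j ∈ S j) → (∀ j, ∀ x ∈ S j, lexKey lc x ≤ lexKey lc (T j)) →
      (∀ j, T' j ∈ S' j) → (∀ j, ∀ x ∈ S' j, lexKey lc x ≤ lexKey lc (T' j)) →
      (∀ j, a j ∈ S j) → ∑ j, a j = e → (∀ j, u j ∈ S' j) → ∑ j, u j = e →
      ∑ j, T j = ∑ j, T' j → lexKey lc e < lexKey lc (∑ j, T j) →
      (∀ b : Fin m → (Fin 2 →₀ ℕ), (∀ j, b j ∈ S j) → ∑ j, b j ≠ e → lc (emb e) ≤ lc (emb (∑ j, b j)) →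
        ∃ c : Fin m → (Fin 2 →₀ ℕ), (∀ j, c j ∈ S' j) ∧ ∑ j, c j = ∑ j, b j) →
      (∀ c : Fin m → (Fin 2 →₀ ℕ), (∀ j, c j ∈ S' j) → ∑ j, c j ≠ e → lc (emb e) ≤ lc (emb (∑ j, c j)) →
        ∃ b : Fin m → (Fin 2 →₀ ℕ), (∀ j, b j ∈ S j) ∧ ∑ j, b j = ∑ j, c j) →
      4 ≤ (Finset.univ.filter fun i => a i ≠ T i).card → 4 ≤ (Finset.univ.filter fun i => u i ≠ T' i).card →
      (∀ j, ∀ x ∈ S j, cf j x ≠ 0) → (∀ j, ∀ x ∈ S' j, cg j x ≠ 0) →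
      (∀ b c : Fin m → (Fin 2 →₀ ℕ), (∀ j, b j ∈ S j) → (∀ j, c j ∈ S' j) → ∑ j, b j = ∑ j, c j →
        ∑ j, b j ≠ e → lc (emb e) ≤ lc (emb (∑ j, b j)) → ∏ j, cf j (b j) + ∏ j, cg j (c j) = 0) →
      ∏ j, cf j (a j) + ∏ j, cg j (u j) = 0) :
    {p : Fin 2 → ℝ | p ∈ Set.extremePoints ℝ (convexHull ℝ
          (emb '' ((∏ j, f j + ∏ j, g j).support : Set (Fin 2 →₀ ℕ)))) ∧
        ∃ l : (Fin 2 → ℝ) →ₗ[ℝ] ℝ,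
          (∀ q ∈ emb '' ((∏ j, f j + ∏ j, g j).support : Set (Fin 2 →₀ ℕ)), q ≠ p → l q < l p) ∧
          ∃ q ∈ emb '' ((∏ j, f j).support : Set (Fin 2 →₀ ℕ)) ∪ emb '' ((∏ j, g j).support : Set (Fin 2 →₀ ℕ)),
            l p < l q}.ncard ≤ (m * t + 2) ^ 8 :=
  crossCancel_of_cores m t A B f g hA hB hf hg hinjA hinjB (outKernel_of_oneD h1D) (bothKernel_of_cancel hCancel)

end OneD

end

end Summit.ValiantsHypothesis.ValiantsHypothesis.Theorems.NewtonFramesTwoProducts.FrameRungTwoTrinomial
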